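import Literature.Probability.Percolation.KestenRelationRussoProofs
import Literature.Probability.Percolation.TriLadder
import Literature.Probability.Percolation.TriShiftedCrossings
import Literature.Probability.Percolation.SiteHarrisChain
import Mathlib.Algebra.Order.Field.GeomSum
import Mathlib.Analysis.SpecificLimits.Basic
import HarnessLib

/-!
# At distance `L(p)` one is not far from infinity: `θ(p) ≥ c · P_p(0 ↔ ∂Λ_{L(p)})`

Topic `Literature/Probability/Percolation`; family `crit-perc`. Layer 3 of the bottom-up
discharge of **crit-perc.S16** (`Literature.Probability.Percolation.triTheta_exponent`): the leaf `Nolin2008_cor41`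
of `NearCriticalScaling.lean` (Nolin 2008, §7.4, Cor. 41 [arXiv 0711.4948: Cor. 39]:
`θ(p) ≍ P_p(0 ⇝ ∂S_{L(p)})` uniformly in `p > 1/2`; Werner 2009, Lecture 6, §1; Kesten 1987) is
reduced to

* the tree's named fact `tri_rsw_half` (RSW box-crossing bounds at `p = 1/2`, `BoxCrossing.lean`),
* the named fact `Nolin2008_subcritical_crossing` (`KestenRelationRusso.lean`; only to know that
  `L_ε(p) → ∞` as `p → 1/2`, `le_charLength_eventually`), and
* ONE new named fact, `Nolin2008_lemma39`: the **uniform exponential decay** of easy-way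
  crossings above the characteristic length (Nolin 2008, §7.4, Lemma 39 with Remark 40
  [arXiv: Lemma 37, Remark 38]: `P_p(𝒞_H([0, n] × [0, k n])) ≤ C₁ e^{-C₂ n / L_ε(p)}` for
  `p < 1/2`),

everything else being PROVED: `Nolin2008_cor41_of_ladder`.

**The printed proof** (Nolin 2008, proof of Cor. 41): "It suffices to consider overlapping
parallelograms (…), each parallelogram twice larger than the previous one, so that
the `k`th of them has a probability at least `1 - C₁ e^{-C₂ 2^k}` to present a crossing in the
'hard' direction (thanks to the previous remark). Since `∏_k (1 - C₁ e^{-C₂ 2^k}) > 0`, we are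
done." We implement it as follows (`p ∈ (1/2, 1/2 + δ)`, `M = L_ε(p) = L_ε(1 - p) ≥ 8`,
`m = ⌊M/4⌋`, `a_k = 2^k m`). The event `ladderEvent M m` asks for the arm `0 ↔ ∂Λ_M`
(`triOneArm M`), the three hook crossings of the annulus `[-2m, 2m]² ∖ (-m, m)²` (`hookTop`,
`hookBot`, `hookLeft`: hard crossings of `4m × m` rectangles) and, for every `k`, hard crossings of
the rung `V_k = [a_k, 2a_k] × [-2a_k, 2a_k]` (`ladderRung`) and of the rail
`H_k = [a_k, 4a_k] × [-a_k, a_k]` (`ladderRail`) — translated crossing events in the format of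
`TriShiftedCrossings.lean`. Deterministically, `ladderEvent M m ⊆ {|C(0)| = ∞}`
(`ladderEvent_subset_sitePercolatesAt`, from `TriLadder.percolates_of_arm`: the arm leaves the
open square `(-2m, 2m)²` because `‖y‖_𝕋 = M ≥ 4m` forces `|y₀| ≥ 2m` or `|y₁| ≥ 2m`).
Probabilistically, all these events are increasing and local, so by Harris–FKG
(`sitePercolation_real_biInter_ge_prod`, `sitePercolation_harris'`)
`θ(p) ≥ P_p(0 ↔ ∂Λ_M) · P_p(hook) · P_p(⋂_{k<k₀} rungs ∩ rails) · P_p(⋂_{k ≥ k₀} rungs ∩ rails)`;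
for `p ≥ 1/2` each hard OPEN crossing is at least as likely as at `p = 1/2`
(`le_real_shift_triLRCrossing_of_half_le`), where `tri_rsw_half` bounds it below by `c > 0`
(aspect ratios `4` and `3/2`), and a hard open crossing fails only if an easy CLOSED crossing of
the same parallelogram occurs (`one_sub_le_real_shift_triLRCrossing`), which at the dual
parameter `1 - p < 1/2` has probability `≤ C₁ e^{-C₂ a_k / L_ε(1-p)} ≤ C₁ e^{-C₂ 2^k / 8}` by
`Nolin2008_lemma39`; a union bound over `k ≥ k₀` (`measureReal_biInter_ge_one_sub_sum`, `k₀`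
depending on `ε` only) makes the last factor `≥ 1/2`, and the infinite intersection is handled by
continuity of the measure along the decreasing sequence of finite intersections
(`tendsto_measure_iInter_atTop`).

## References

* P. Nolin, Near-critical percolation in two dimensions, *Electron. J. Probab.* 13 (2008)
  1562–1623, §7.4: Lemma 39, Remark 40, Cor. 41 (arXiv 0711.4948: Lemma 37, Remark 38, Cor. 39)
  [Nolin2008].
* W. Werner, Lectures on two-dimensional critical percolation, PCMI (2009), Lecture 6, §1
  [WernerPCMI2009].
* H. Kesten, Scaling relations for 2D-percolation, *Comm. Math. Phys.* 109 (1987) [KestenScalingCMP1987].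

Tree: `charLength`, `charLength_symm` (`KestenScaling.lean`), `le_charLength_eventually`
(`KestenRelationRusso.lean`), `BollobasRiordan2006_ch5_lemma7_holds`
(`KestenRelationRussoProofs.lean`), `Nolin2008_cor41`, `isUpperSet_triOneArm`,
`determinedBy_triOneArm` (`NearCriticalScaling.lean`), `tri_rsw_half` (`BoxCrossing.lean`),
`TriLadder.percolates_of_arm` (`TriLadder.lean`), `TriShiftedCrossings.lean`,
`SiteHarrisChain.lean`. Mathlib: `geom_sum_Ico_le_of_lt_one`, `exists_pow_lt_of_lt_one`,
`tendsto_measure_iInter_atTop`, `Real.exp`.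
-/

noncomputable section

open MeasureTheory Set Filter Topology
open scoped unitInterval

namespace Literature.Probability.Percolation

open LatticeModels

/-! ### The named fact: uniform exponential decay above `L(p)` -/

/-- **Uniform exponential decay** (Nolin 2008, §7.4, Lemma 39 [arXiv 0711.4948: Lemma 37]: "For
any `ε ∈ (0, 1/2)`, there exist constants `C_i = C_i(ε) > 0` such that for all `p < 1/2`, all `n`,
`P_p(𝒞_H([0, n] × [0, n])) ≤ C₁ e^{-C₂ n / L_ε(p)}`", together with Remark 40 [arXiv: Remark 38]:
"we also have for any `k ≥ 1`, `P_p(𝒞_H([0, n] × [0, k n])) ≤ C₁^{(k)} e^{-C₂^{(k)} n / L(p)}`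
for some constants `C_i^{(k)}` (depending on `k` and `ε`)" — crossings of longer parallelograms
"in the easy way"). Conventions: Nolin's `𝒞_H([0, n] × [0, k n])` (a left–right crossing of the
parallelogram of width `n` and height `k n`) is the tree's `triLRCrossing n (k * n)`
(`BoxCrossing.lean`), and `L_ε` is `charLength ε` (`KestenScaling.lean`). We record the bound for
`ε < p < 1/2` and `n ≥ 1` only: for `p ≤ ε` the tree's `charLength ε p` may vanish (its infimum
ranges over `n ∈ ℕ`, and the single-site parallelogram `[0, 0]²` is crossed with probability
`p ≤ ε`), a degenerate case outside Nolin's convention `L_ε(p) ≥ 1`; on `ε < p < 1/2` the two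
lengths agree. **Structure of the printed proof** (arXiv p. 26): the block argument
(7.21)–(7.23) proves the bound only "for any `ε` below some fixed value `ε₀` (given by RSW)" — in
the tree this part is a theorem (`Nolin2008_lemma39_at_holds_small`, `NearCriticalRSWStart.lean`;
`Nolin2008_lemma39_small`, `NearCriticalRSW.lean`), and it is all that the assembly of
`triTheta_exponent` uses (`Nolin2008_cor41_at_of_ladder` below, `triTheta_exponent_of_leaves5`) —
while "the result for any `ε ∈ (0, 1/2)` follows readily by using the equivalence of lengths for
different values of `ε`" (Cor. 37 [arXiv: Cor. 35], `L_ε ≍ L_{ε'}`), whose proof rests on Kesten's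
relation (Prop. 34 [arXiv: Prop. 32]), the quasi-multiplicativity of four arms and the five-arm
a priori bound below `L(p)`; accordingly the present every-`ε` statement is reduced in the tree to
near-critical four-arm separation (`Nolin2008_lemma39_of_separation`,
`NearCriticalRadiusDecayFromSeparation.lean`; also `Nolin2008_lemma39_of_leaves`,
`NearCriticalArmProofs.lean`), and its discharge is that reduction applied to the separation
theorem (Nolin's Thm. 11 [arXiv: Thm. 10] for `j = 4` below `L(p)`). [cite: Nolin2008, §7.4, Lemma 39 and Remark 40 with its proof, last paragraph (arXiv 0711.4948: Lemma 37, Remark 38, p. 26)] -/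
def Nolin2008_lemma39 : Prop :=
  ∀ ⦃ε : ℝ⦄, 0 < ε → ε < 1 / 2 → ∀ k : ℕ, 1 ≤ k →
    ∃ C₁ > (0 : ℝ), ∃ C₂ > (0 : ℝ), ∀ p : unitInterval, ε < (p : ℝ) → (p : ℝ) < 1 / 2 →
      ∀ n : ℕ, 1 ≤ n →
        triLRCrossingProb p n (k * n) ≤ C₁ * Real.exp (-(C₂ * n / charLength ε p))

/-! ### The ladder events -/

/-- The scales `a_k = 2^k m` of the ladder. [folklore] -/
def ladderScale (m k : ℕ) : ℕ := 2 ^ k * m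

/-- `a_0 = m`. [folklore] -/
@[simp] theorem ladderScale_zero (m : ℕ) : ladderScale m 0 = m := by simp [ladderScale]

/-- `a_{k+1} = 2 a_k`. [folklore] -/
theorem ladderScale_succ (m k : ℕ) : ladderScale m (k + 1) = 2 * ladderScale m k := by
  simp [ladderScale, pow_succ]; ring

/-- `a_k ≥ 1` for `m ≥ 1`. [folklore] -/
theorem ladderScale_pos {m : ℕ} (hm : 1 ≤ m) (k : ℕ) : 1 ≤ ladderScale m k :=
  Nat.one_le_iff_ne_zero.2 (by simp [ladderScale]; omega)

/-- Hook, top: an open left–right crossing of `[-2m, 2m] × [m, 2m]`. [cite: Nolin2008, §7.4, Cor. 41 (proof; arXiv 0711.4948: Cor. 39)] -/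
def hookTop (m : ℕ) : Set (SiteConfig (Site 2)) :=
  SiteConfig.relabel (triShiftIso (-![-(2 * (m : ℤ)), (m : ℤ)])).toEquiv ⁻¹' triLRCrossing (4 * m) m

/-- Hook, bottom: an open left–right crossing of `[-2m, 2m] × [-2m, -m]`. [cite: Nolin2008, §7.4, Cor. 41 (proof; arXiv 0711.4948: Cor. 39)] -/
def hookBot (m : ℕ) : Set (SiteConfig (Site 2)) :=
  SiteConfig.relabel (triShiftIso (-![-(2 * (m : ℤ)), -(2 * (m : ℤ))])).toEquiv ⁻¹'
    triLRCrossing (4 * m) m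

/-- Hook, left: an open top–bottom crossing of `[-2m, -m] × [-2m, 2m]`. [cite: Nolin2008, §7.4, Cor. 41 (proof; arXiv 0711.4948: Cor. 39)] -/
def hookLeft (m : ℕ) : Set (SiteConfig (Site 2)) :=
  SiteConfig.relabel (triShiftIso (-![-(2 * (m : ℤ)), -(2 * (m : ℤ))])).toEquiv ⁻¹'
    triTBCrossing m (4 * m)

/-- Rung `k`: an open top–bottom crossing of `V_k = [a_k, 2a_k] × [-2a_k, 2a_k]`, `a_k = 2^k m`
(for `k = 0` the right rectangle of the hook annulus). [cite: Nolin2008, §7.4, Cor. 41 (proof; arXiv 0711.4948: Cor. 39)] -/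
def ladderRung (m k : ℕ) : Set (SiteConfig (Site 2)) :=
  SiteConfig.relabel (triShiftIso
      (-![(ladderScale m k : ℤ), -(2 * (ladderScale m k : ℤ))])).toEquiv ⁻¹'
    triTBCrossing (ladderScale m k) (4 * ladderScale m k)

/-- Rail `k`: an open left–right crossing of `H_k = [a_k, 4a_k] × [-a_k, a_k]`, `a_k = 2^k m`. [cite: Nolin2008, §7.4, Cor. 41 (proof; arXiv 0711.4948: Cor. 39)] -/
def ladderRail (m k : ℕ) : Set (SiteConfig (Site 2)) :=
  SiteConfig.relabel (triShiftIso
      (-![(ladderScale m k : ℤ), -(ladderScale m k : ℤ)])).toEquiv ⁻¹'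
    triLRCrossing (3 * ladderScale m k) (2 * ladderScale m k)

/-- **The ladder event** at arm scale `M` and hook scale `m`: the arm `0 ↔ ∂Λ_M`, the three hook
crossings, and all rungs and rails. [cite: Nolin2008, §7.4, Cor. 41 (proof; arXiv 0711.4948: Cor. 39)] -/
def ladderEvent (M m : ℕ) : Set (SiteConfig (Site 2)) :=
  triOneArm M ∩ hookTop m ∩ hookBot m ∩ hookLeft m ∩ (⋂ k, ladderRung m k) ∩ (⋂ k, ladderRail m k)

/-! ### The ladder event forces percolation -/

/-- A site of `𝕋`-norm at least `4m` has a coordinate of absolute value at least `2m`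
(`‖x‖_𝕋 = max(|x₀|, |x₁|, |x₀ + x₁|)`). [folklore] -/
theorem coord_large_of_triNorm_ge {y : Site 2} {m : ℤ} (h : 4 * m ≤ triNorm y) :
    y 0 ≤ -(2 * m) ∨ 2 * m ≤ y 0 ∨ y 1 ≤ -(2 * m) ∨ 2 * m ≤ y 1 := by
  by_contra hcon
  simp only [not_or, not_le] at hcon
  obtain ⟨h1, h2, h3, h4⟩ := hcon
  have hlt : triNorm y < 4 * m := by
    unfold triNorm
    refine max_lt ?_ (max_lt ?_ ?_) <;> rw [abs_lt] <;> constructor <;> omega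
  omega

/-- **The ladder event forces percolation** (`m ≥ 1`, `4m ≤ M`): the arm reaches `‖y‖_𝕋 = M`,
hence leaves the open square `(-2m, 2m)²`, and `TriLadder.percolates_of_arm` applies to the paths
extracted from the translated crossing events (`pathIn_of_mem_shift_triLRCrossing` /
`pathIn_of_mem_shift_triTBCrossing`) with `a k = 2^k m`. [cite: Nolin2008, §7.4, Cor. 41 (proof; arXiv 0711.4948: Cor. 39)] -/
theorem ladderEvent_subset_sitePercolatesAt {M m : ℕ} (hm : 1 ≤ m) (hM : 4 * m ≤ M) :
    ladderEvent M m ⊆ sitePercolatesAt triGraph 0 := by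
  intro ω hω
  obtain ⟨⟨⟨⟨⟨hA, hT⟩, hB⟩, hL⟩, hR⟩, hH⟩ := hω
  -- the scale sequence
  set a : ℕ → ℤ := fun k => (ladderScale m k : ℤ) with ha
  have ha_succ : ∀ k, a (k + 1) = 2 * a k := fun k => by
    simp only [ha, ladderScale_succ]; push_cast; ring
  have ha_mono : StrictMono a := by
    refine strictMono_nat_of_lt_succ fun k => ?_
    have : (1 : ℤ) ≤ a k := by simp only [ha]; exact_mod_cast ladderScale_pos hm k
    rw [ha_succ]; omega
  have ha0 : a 0 = m := by simp [ha]
  have ha1 : a 1 = 2 * (m : ℤ) := by rw [ha_succ, ha0]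
  -- the arm
  obtain ⟨y, hy, hy'⟩ := hA
  have harm : PathIn triGraph ω 0 y :=
    (PathIn.of_mem_siteConnIn hy').mono Set.inter_subset_right
  have hyN : triNorm y = M := by simpa using hy
  have hyout := coord_large_of_triNorm_ge (y := y) (m := m) (by rw [hyN]; exact_mod_cast hM)
  -- the paths, in the coordinates of `TriLadder`
  have cv0 : ∀ (u v : ℤ), (![u, v] : Site 2) 0 = u := fun u v => rfl
  have cv1 : ∀ (u v : ℤ), (![u, v] : Site 2) 1 = v := fun u v => rfl
  obtain ⟨ut, vt, hut, hvt, hpt⟩ := pathIn_of_mem_shift_triLRCrossing hT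
  obtain ⟨ub, vb, hub, hvb, hpb⟩ := pathIn_of_mem_shift_triLRCrossing hB
  obtain ⟨ul, vl, hul, hvl, hpl⟩ := pathIn_of_mem_shift_triTBCrossing hL
  simp only [cv0, cv1, Nat.cast_mul, Nat.cast_ofNat] at hut hvt hpt hub hvb hpb hul hvl hpl
  refine TriLadder.percolates_of_arm (m := (m : ℤ)) (a := a) (by exact_mod_cast hm) ha_mono ha0 ha1
    ⟨y, hyout, harm⟩ ⟨ut, vt, hut, by rw [hvt]; ring, hpt.mono fun z hz => ⟨hz.1, ?_⟩⟩
    ⟨ub, vb, hub, by rw [hvb]; ring, hpb.mono fun z hz => ⟨hz.1, ?_⟩⟩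
    ⟨ul, vl, hul, by rw [hvl]; ring, hpl.mono fun z hz => ⟨hz.1, ?_⟩⟩ (fun k => ?_) (fun k => ?_)
  · have := hz.2; simp only [Set.mem_setOf_eq] at this ⊢; omega
  · have := hz.2; simp only [Set.mem_setOf_eq] at this ⊢; omega
  · have := hz.2; simp only [Set.mem_setOf_eq] at this ⊢; omega
  · -- rung `k`
    obtain ⟨u, v, hu, hv, hp⟩ := pathIn_of_mem_shift_triTBCrossing (Set.mem_iInter.1 hR k)
    simp only [cv0, cv1, Nat.cast_mul, Nat.cast_ofNat] at hu hv hp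
    have hk := ha_succ k
    simp only [ha] at hk
    refine ⟨u, v, ?_, ?_, hp.mono fun z hz => ⟨hz.1, ?_⟩⟩
    · simp only [ha]; rw [hu, hk]
    · simp only [ha]; rw [hv, hk]; ring
    · have := hz.2
      simp only [Set.mem_setOf_eq, ha] at this ⊢
      rw [hk]; omega
  · -- rail `k`
    obtain ⟨u, v, hu, hv, hp⟩ := pathIn_of_mem_shift_triLRCrossing (Set.mem_iInter.1 hH k)
    simp only [cv0, cv1, Nat.cast_mul, Nat.cast_ofNat] at hu hv hp
    have hk := ha_succ k
    have hk' := ha_succ (k + 1)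
    simp only [ha] at hk hk'
    refine ⟨u, v, ?_, ?_, hp.mono fun z hz => ⟨hz.1, ?_⟩⟩
    · simp only [ha]; rw [hu]
    · simp only [ha]; rw [hv, hk', hk]; ring
    · have := hz.2
      simp only [Set.mem_setOf_eq, ha] at this ⊢
      rw [hk', hk]; omega

/-! ### The building blocks are increasing local events; their probabilities -/

/-- RSW at `p = 1/2` for the two aspect ratios of the ladder (`4` and `3/2`): a common lower
bound `c > 0` for `P_{1/2}(LR(4n, n))`, `n ≥ 1`, and `P_{1/2}(LR(3a, 2a))`, `a ≥ 1`. [cite: KestenPTM1982, §3.4] -/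
theorem rsw_ladder_constant (hrsw : tri_rsw_half) :
    ∃ c > (0 : ℝ), (∀ n : ℕ, 1 ≤ n → c ≤ triLRCrossingProb half (4 * n) n) ∧
      (∀ a : ℕ, 1 ≤ a → c ≤ triLRCrossingProb half (3 * a) (2 * a)) := by
  obtain ⟨c₄, hc₄, h₄⟩ := hrsw 4 (by norm_num)
  obtain ⟨c₃, hc₃, h₃⟩ := hrsw (3 / 2) (by norm_num)
  refine ⟨min c₄ c₃, lt_min hc₄ hc₃, fun n hn => ?_, fun a ha => ?_⟩
  · have hfl : ⌊(4 : ℝ) * (n : ℝ)⌋₊ = 4 * n := by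
      rw [show (4 : ℝ) * (n : ℝ) = ((4 * n : ℕ) : ℝ) by push_cast; ring, Nat.floor_natCast]
    have := (h₄ n (by rw [hfl]; omega)).1
    rw [hfl] at this
    exact (min_le_left _ _).trans this
  · have hfl : ⌊(3 / 2 : ℝ) * ((2 * a : ℕ) : ℝ)⌋₊ = 3 * a := by
      rw [show (3 / 2 : ℝ) * ((2 * a : ℕ) : ℝ) = ((3 * a : ℕ) : ℝ) by push_cast; ring,
        Nat.floor_natCast]
    have := (h₃ (2 * a) (by rw [hfl]; omega)).1
    rw [hfl] at this
    exact (min_le_right _ _).trans this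

/-- `P_p(hookTop m) ≥ P_{1/2}(LR(4m, m))` for `p ≥ 1/2`. [folklore] -/
theorem le_real_hookTop {p : unitInterval} (hp : half ≤ p) (m : ℕ) :
    triLRCrossingProb half (4 * m) m ≤ (triSitePercolation p).real (hookTop m) :=
  le_real_shift_triLRCrossing_of_half_le hp _ _ _

/-- `P_p(hookBot m) ≥ P_{1/2}(LR(4m, m))` for `p ≥ 1/2`. [folklore] -/
theorem le_real_hookBot {p : unitInterval} (hp : half ≤ p) (m : ℕ) :
    triLRCrossingProb half (4 * m) m ≤ (triSitePercolation p).real (hookBot m) :=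
  le_real_shift_triLRCrossing_of_half_le hp _ _ _

/-- `P_p(hookLeft m) ≥ P_{1/2}(LR(4m, m))` for `p ≥ 1/2`. [folklore] -/
theorem le_real_hookLeft {p : unitInterval} (hp : half ≤ p) (m : ℕ) :
    triLRCrossingProb half (4 * m) m ≤ (triSitePercolation p).real (hookLeft m) :=
  le_real_shift_triTBCrossing_of_half_le hp _ _ _

/-- `P_p(ladderRung m k) ≥ P_{1/2}(LR(4a_k, a_k))` for `p ≥ 1/2`. [folklore] -/
theorem le_real_ladderRung {p : unitInterval} (hp : half ≤ p) (m k : ℕ) :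
    triLRCrossingProb half (4 * ladderScale m k) (ladderScale m k) ≤
      (triSitePercolation p).real (ladderRung m k) :=
  le_real_shift_triTBCrossing_of_half_le hp _ _ _

/-- `P_p(ladderRail m k) ≥ P_{1/2}(LR(3a_k, 2a_k))` for `p ≥ 1/2`. [folklore] -/
theorem le_real_ladderRail {p : unitInterval} (hp : half ≤ p) (m k : ℕ) :
    triLRCrossingProb half (3 * ladderScale m k) (2 * ladderScale m k) ≤
      (triSitePercolation p).real (ladderRail m k) :=
  le_real_shift_triLRCrossing_of_half_le hp _ _ _

/-- **Duality bound for a rung**: `1 - P_p(ladderRung m k) ≤ P_{1-p}(LR(a_k, 4a_k))` (an open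
hard crossing fails only if a closed easy crossing occurs). [cite: Nolin2008, §7.4, Cor. 41 (proof; arXiv 0711.4948: Cor. 39)] -/
theorem one_sub_real_ladderRung_le (p : unitInterval) (m k : ℕ) :
    1 - (triSitePercolation p).real (ladderRung m k) ≤
      triLRCrossingProb (σ p) (ladderScale m k) (4 * ladderScale m k) := by
  have := one_sub_le_real_shift_triTBCrossing p
    (![(ladderScale m k : ℤ), -(2 * (ladderScale m k : ℤ))]) (ladderScale m k) (4 * ladderScale m k)
  rw [ladderRung]; linarith

/-- **Duality bound for a rail**: `1 - P_p(ladderRail m k) ≤ P_{1-p}(LR(2a_k, 4a_k))` (the closed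
easy crossing of `H_k` is a top–bottom crossing of a `3a_k × 2a_k` parallelogram, i.e. a
left–right crossing of a `2a_k × 3a_k` one, contained in that of the taller `2a_k × 4a_k` one). [cite: Nolin2008, §7.4, Cor. 41 (proof; arXiv 0711.4948: Cor. 39)] -/
theorem one_sub_real_ladderRail_le (p : unitInterval) (m k : ℕ) :
    1 - (triSitePercolation p).real (ladderRail m k) ≤
      triLRCrossingProb (σ p) (2 * ladderScale m k) (2 * (2 * ladderScale m k)) := by
  have h1 := one_sub_le_real_shift_triLRCrossing p
    (![(ladderScale m k : ℤ), -(ladderScale m k : ℤ)]) (3 * ladderScale m k) (2 * ladderScale m k)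
  have h2 := triLRCrossingProb_mono_height (σ p) (2 * ladderScale m k)
    (show 3 * ladderScale m k ≤ 2 * (2 * ladderScale m k) by omega)
  rw [ladderRail]; linarith

/-! ### The analytic bookkeeping: choice of `k₀` -/

/-- **Choice of `k₀`.** Given the constants of `Nolin2008_lemma39` for `k = 4` and `k = 2`, there
is `k₀` (depending on them only) such that, whenever `m ≥ 1` and `4m ≤ M < 8m`, the tail sums of
the duality bounds over `k₀ ≤ k < k₀ + K` are at most `1/4` each: with `a_k = 2^k m ≥ 2^k M / 8`
the `k`th terms are at most `C e^{-κ 2^k} ≤ C r^k`, `r = e^{-κ} < 1`, a geometric tail. [cite: Nolin2008, §7.4, Cor. 41 (proof; arXiv 0711.4948: Cor. 39)] -/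
theorem ladder_tail_index {C₁ C₂ C₁' C₂' : ℝ} (hC₁ : 0 < C₁) (hC₂ : 0 < C₂) (hC₁' : 0 < C₁')
    (hC₂' : 0 < C₂') :
    ∃ k₀ : ℕ, ∀ M m : ℕ, 1 ≤ m → 4 * m ≤ M → M < 8 * m → ∀ K : ℕ,
      (∑ k ∈ Finset.Ico k₀ (k₀ + K),
          C₁ * Real.exp (-(C₂ * (ladderScale m k : ℕ) / (M : ℝ)))) ≤ 1 / 4 ∧
        (∑ k ∈ Finset.Ico k₀ (k₀ + K),
          C₁' * Real.exp (-(C₂' * ((2 * ladderScale m k : ℕ) : ℝ) / (M : ℝ)))) ≤ 1 / 4 := by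
  set κ : ℝ := min (C₂ / 8) (C₂' / 4) with hκ
  have hκ0 : 0 < κ := lt_min (by positivity) (by positivity)
  set r : ℝ := Real.exp (-κ) with hr
  have hr0 : 0 < r := Real.exp_pos _
  have hr1 : r < 1 := Real.exp_lt_one_iff.2 (by linarith)
  set C : ℝ := max C₁ C₁' with hC
  have hC0 : 0 < C := lt_max_of_lt_left hC₁
  -- `k₀` with `C r^{k₀} / (1 - r) ≤ 1/4`
  obtain ⟨k₀, hk₀⟩ := exists_pow_lt_of_lt_one (show 0 < (1 - r) / (4 * C) by
    apply div_pos <;> linarith) hr1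
  refine ⟨k₀, fun M m hm hM hM' K => ?_⟩
  have hMpos : (0 : ℝ) < M := by exact_mod_cast (show 0 < M by omega)
  -- the generic term bound: `exp(-(c * a / M)) ≤ r ^ k` when `c * a / M ≥ κ * 2^k`
  have key : ∀ (c : ℝ) (A : ℕ) (k : ℕ), κ * (2 : ℝ) ^ k ≤ c * (A : ℝ) / M →
      Real.exp (-(c * (A : ℝ) / M)) ≤ r ^ k := by
    intro c A k h
    rw [hr, ← Real.exp_nat_mul]
    apply Real.exp_le_exp.2
    have h2k : (k : ℝ) ≤ (2 : ℝ) ^ k := by exact_mod_cast (Nat.lt_two_pow_self).le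
    nlinarith [mul_le_mul_of_nonneg_left h2k hκ0.le]
  have geom : ∑ k ∈ Finset.Ico k₀ (k₀ + K), C * r ^ k ≤ 1 / 4 := by
    rw [← Finset.mul_sum]
    have hg := geom_sum_Ico_le_of_lt_one hr0.le hr1 (m := k₀) (n := k₀ + K)
    have h1r : 0 < 1 - r := by linarith
    calc C * ∑ i ∈ Finset.Ico k₀ (k₀ + K), r ^ i ≤ C * (r ^ k₀ / (1 - r)) :=
          mul_le_mul_of_nonneg_left hg hC0.le
      _ ≤ C * ((1 - r) / (4 * C) / (1 - r)) := by
          apply mul_le_mul_of_nonneg_left _ hC0.le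
          exact div_le_div_of_nonneg_right hk₀.le h1r.le
      _ = 1 / 4 := by field_simp
  have hmM : ∀ k : ℕ, κ * (2 : ℝ) ^ k ≤ C₂ * ((ladderScale m k : ℕ) : ℝ) / M ∧
      κ * (2 : ℝ) ^ k ≤ C₂' * ((2 * ladderScale m k : ℕ) : ℝ) / M := by
    intro k
    have hM8 : (M : ℝ) < 8 * m := by exact_mod_cast hM'
    have hak : ((ladderScale m k : ℕ) : ℝ) = (2 : ℝ) ^ k * m := by simp [ladderScale]
    have h2pos : (0 : ℝ) < (2 : ℝ) ^ k := by positivity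
    have hmpos : (0 : ℝ) < m := by exact_mod_cast (show 0 < m by omega)
    constructor
    · rw [le_div_iff₀ hMpos, hak]
      have hle : κ ≤ C₂ / 8 := min_le_left _ _
      calc κ * (2 : ℝ) ^ k * M ≤ C₂ / 8 * (2 : ℝ) ^ k * M := by gcongr
        _ ≤ C₂ / 8 * (2 : ℝ) ^ k * (8 * m) := by gcongr
        _ = C₂ * ((2 : ℝ) ^ k * m) := by ring
    · rw [le_div_iff₀ hMpos, Nat.cast_mul, Nat.cast_ofNat, hak]
      have hle : κ ≤ C₂' / 4 := min_le_right _ _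
      calc κ * (2 : ℝ) ^ k * M ≤ C₂' / 4 * (2 : ℝ) ^ k * M := by gcongr
        _ ≤ C₂' / 4 * (2 : ℝ) ^ k * (8 * m) := by gcongr
        _ = C₂' * (2 * ((2 : ℝ) ^ k * m)) := by ring
  constructor
  · refine le_trans (Finset.sum_le_sum fun k _ => ?_) geom
    calc C₁ * Real.exp (-(C₂ * ((ladderScale m k : ℕ) : ℝ) / M)) ≤ C₁ * r ^ k :=
          mul_le_mul_of_nonneg_left (key C₂ _ k (hmM k).1) hC₁.le
      _ ≤ C * r ^ k := mul_le_mul_of_nonneg_right (le_max_left _ _) (pow_nonneg hr0.le k)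
  · refine le_trans (Finset.sum_le_sum fun k _ => ?_) geom
    calc C₁' * Real.exp (-(C₂' * ((2 * ladderScale m k : ℕ) : ℝ) / M)) ≤ C₁' * r ^ k :=
          mul_le_mul_of_nonneg_left (key C₂' _ k (hmM k).2) hC₁'.le
      _ ≤ C * r ^ k := mul_le_mul_of_nonneg_right (le_max_right _ _) (pow_nonneg hr0.le k)

/-! ### The finite-ladder events: locality, monotonicity, probability -/

/-- The finite-ladder event with head `k < k₀` and tail `k₀ ≤ k < k₀ + K`. [cite: Nolin2008, §7.4, Cor. 41 (proof; arXiv 0711.4948: Cor. 39)] -/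
def ladderEventFin (M m k₀ K : ℕ) : Set (SiteConfig (Site 2)) :=
  triOneArm M ∩ ((hookTop m ∩ hookBot m ∩ hookLeft m ∩
    ((⋂ k ∈ Finset.range k₀, ladderRung m k) ∩ (⋂ k ∈ Finset.range k₀, ladderRail m k))) ∩
    ((⋂ k ∈ Finset.Ico k₀ (k₀ + K), ladderRung m k) ∩ (⋂ k ∈ Finset.Ico k₀ (k₀ + K), ladderRail m k)))

/-- The finite-ladder events decrease to (a subset of) the ladder event. [folklore] -/
theorem iInter_ladderEventFin_subset (M m k₀ : ℕ) :
    (⋂ K, ladderEventFin M m k₀ K) ⊆ ladderEvent M m := by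
  intro ω hω
  rw [Set.mem_iInter] at hω
  have h0 := hω 0
  obtain ⟨hA, ⟨⟨⟨hT, hB⟩, hL⟩, hHR, hHH⟩, -⟩ := h0
  refine ⟨⟨⟨⟨⟨hA, hT⟩, hB⟩, hL⟩, Set.mem_iInter.2 fun k => ?_⟩, Set.mem_iInter.2 fun k => ?_⟩
  · rcases lt_or_ge k k₀ with hk | hk
    · exact (Set.mem_iInter₂.1 hHR) k (Finset.mem_range.2 hk)
    · obtain ⟨-, -, hTR, -⟩ := hω (k + 1)
      exact (Set.mem_iInter₂.1 hTR) k (Finset.mem_Ico.2 ⟨hk, by omega⟩)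
  · rcases lt_or_ge k k₀ with hk | hk
    · exact (Set.mem_iInter₂.1 hHH) k (Finset.mem_range.2 hk)
    · obtain ⟨-, -, -, hTH⟩ := hω (k + 1)
      exact (Set.mem_iInter₂.1 hTH) k (Finset.mem_Ico.2 ⟨hk, by omega⟩)

/-- The finite-ladder events are decreasing in the tail length. [folklore] -/
theorem antitone_ladderEventFin (M m k₀ : ℕ) : Antitone (ladderEventFin M m k₀) := by
  refine antitone_nat_of_succ_le fun K => ?_
  have hsub : Finset.Ico k₀ (k₀ + K) ⊆ Finset.Ico k₀ (k₀ + (K + 1)) :=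
    Finset.Ico_subset_Ico_right (by omega)
  rintro ω ⟨hA, hH, hTR, hTH⟩
  exact ⟨hA, hH, Set.biInter_subset_biInter_left hsub hTR, Set.biInter_subset_biInter_left hsub hTH⟩

/-- The sites on which the finite-ladder event depends. [folklore] -/
def ladderFinset (M m N : ℕ) : Finset (Site 2) :=
  triBall M ∪ (rectangle (4 * m) m).image (fun z => z + ![-(2 * (m : ℤ)), (m : ℤ)]) ∪
    (rectangle (4 * m) m).image (fun z => z + ![-(2 * (m : ℤ)), -(2 * (m : ℤ))]) ∪
    (rectangle m (4 * m)).image (fun z => z + ![-(2 * (m : ℤ)), -(2 * (m : ℤ))]) ∪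
    (Finset.range N).biUnion (fun k => (rectangle (ladderScale m k) (4 * ladderScale m k)).image
      (fun z => z + ![(ladderScale m k : ℤ), -(2 * (ladderScale m k : ℤ))])) ∪
    (Finset.range N).biUnion (fun k =>
      (rectangle (3 * ladderScale m k) (2 * ladderScale m k)).image
        (fun z => z + ![(ladderScale m k : ℤ), -(ladderScale m k : ℤ)]))

section Locality

variable (M m k₀ K : ℕ)

/-- The arm event is determined by the sites of `ladderFinset`. [folklore] -/
theorem determinedBy_arm_fin : DeterminedBy (triOneArm M) ↑(ladderFinset M m (k₀ + K)) :=
  (determinedBy_triOneArm M).mono fun z hz => by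
    simp only [ladderFinset, Finset.coe_union, Set.mem_union]
    exact Or.inl (Or.inl (Or.inl (Or.inl (Or.inl hz))))

/-- The top hook crossing is determined by the sites of `ladderFinset`. [folklore] -/
theorem determinedBy_hookTop_fin : DeterminedBy (hookTop m) ↑(ladderFinset M m (k₀ + K)) :=
  (determinedBy_shift_triLRCrossing _ _ _).mono fun z hz => by
    simp only [ladderFinset, Finset.coe_union, Set.mem_union]
    exact Or.inl (Or.inl (Or.inl (Or.inl (Or.inr hz))))

/-- The bottom hook crossing is determined by the sites of `ladderFinset`. [folklore] -/
theorem determinedBy_hookBot_fin : DeterminedBy (hookBot m) ↑(ladderFinset M m (k₀ + K)) :=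
  (determinedBy_shift_triLRCrossing _ _ _).mono fun z hz => by
    simp only [ladderFinset, Finset.coe_union, Set.mem_union]
    exact Or.inl (Or.inl (Or.inl (Or.inr hz)))

/-- The left hook crossing is determined by the sites of `ladderFinset`. [folklore] -/
theorem determinedBy_hookLeft_fin : DeterminedBy (hookLeft m) ↑(ladderFinset M m (k₀ + K)) :=
  (determinedBy_shift_triTBCrossing _ _ _).mono fun z hz => by
    simp only [ladderFinset, Finset.coe_union, Set.mem_union]
    exact Or.inl (Or.inl (Or.inr hz))

/-- Finitely many rungs (indices below `k₀ + K`) are determined by the sites of `ladderFinset`. [folklore] -/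
theorem determinedBy_rungs_fin {s : Finset ℕ} (hs : s ⊆ Finset.range (k₀ + K)) :
    DeterminedBy (⋂ k ∈ s, ladderRung m k) ↑(ladderFinset M m (k₀ + K)) := by
  classical
  refine (DeterminedBy.biInter_finset s fun k _ => determinedBy_shift_triTBCrossing
    (![(ladderScale m k : ℤ), -(2 * (ladderScale m k : ℤ))]) (ladderScale m k)
    (4 * ladderScale m k)).mono fun z hz => ?_
  simp only [ladderFinset, Finset.coe_union, Set.mem_union]
  refine Or.inl (Or.inr ?_)
  rw [Finset.mem_coe] at hz ⊢
  exact Finset.biUnion_subset_biUnion_of_subset_left _ hs hz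

/-- Finitely many rails (indices below `k₀ + K`) are determined by the sites of `ladderFinset`. [folklore] -/
theorem determinedBy_rails_fin {s : Finset ℕ} (hs : s ⊆ Finset.range (k₀ + K)) :
    DeterminedBy (⋂ k ∈ s, ladderRail m k) ↑(ladderFinset M m (k₀ + K)) := by
  classical
  refine (DeterminedBy.biInter_finset s fun k _ => determinedBy_shift_triLRCrossing
    (![(ladderScale m k : ℤ), -(ladderScale m k : ℤ)]) (3 * ladderScale m k)
    (2 * ladderScale m k)).mono fun z hz => ?_
  simp only [ladderFinset, Finset.coe_union, Set.mem_union]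
  refine Or.inr ?_
  rw [Finset.mem_coe] at hz ⊢
  exact Finset.biUnion_subset_biUnion_of_subset_left _ hs hz

/-- `range k₀ ⊆ range (k₀ + K)`. [folklore] -/
theorem range_subset_range_add : Finset.range k₀ ⊆ Finset.range (k₀ + K) :=
  Finset.range_subset_range.2 (Nat.le_add_right k₀ K)

/-- `Ico k₀ (k₀ + K) ⊆ range (k₀ + K)`. [folklore] -/
theorem Ico_subset_range_add : Finset.Ico k₀ (k₀ + K) ⊆ Finset.range (k₀ + K) := by
  rw [Finset.range_eq_Ico]; exact Finset.Ico_subset_Ico_left (Nat.zero_le k₀)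

end Locality

/-- The top hook crossing is an increasing event. [folklore] -/
theorem isUpperSet_hookTop (m : ℕ) : IsUpperSet (hookTop m) := isUpperSet_shift_triLRCrossing _ _ _
/-- The bottom hook crossing is an increasing event. [folklore] -/
theorem isUpperSet_hookBot (m : ℕ) : IsUpperSet (hookBot m) := isUpperSet_shift_triLRCrossing _ _ _
/-- The left hook crossing is an increasing event. [folklore] -/
theorem isUpperSet_hookLeft (m : ℕ) : IsUpperSet (hookLeft m) := isUpperSet_shift_triTBCrossing _ _ _
/-- Rungs are increasing events. [folklore] -/
theorem isUpperSet_ladderRung (m k : ℕ) : IsUpperSet (ladderRung m k) :=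
  isUpperSet_shift_triTBCrossing _ _ _
/-- Rails are increasing events. [folklore] -/
theorem isUpperSet_ladderRail (m k : ℕ) : IsUpperSet (ladderRail m k) :=
  isUpperSet_shift_triLRCrossing _ _ _

/-- `P(X ∩ Y) ≥ P(X) + P(Y) - 1`. [folklore] -/
theorem measureReal_inter_ge_add_sub_one {Ω : Type*} [MeasurableSpace Ω] (μ : Measure Ω)
    [IsProbabilityMeasure μ] {X Y : Set Ω} (hY : MeasurableSet Y) :
    μ.real X + μ.real Y - 1 ≤ μ.real (X ∩ Y) := by
  have h1 := measureReal_union_add_inter (μ := μ) (s := X) hY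
  have h2 : μ.real (X ∪ Y) ≤ 1 := by
    calc μ.real (X ∪ Y) ≤ μ.real Set.univ := measureReal_mono (Set.subset_univ _) (measure_ne_top _ _)
      _ = 1 := probReal_univ
  linarith

/-- **Harris–FKG and the union bound for the finite ladder.** If the hook crossings, rungs and
rails each have probability at least `c ≥ 0`, and the tail sums over `k₀ ≤ k < k₀ + K` of the
failure probabilities of rungs and of rails are at most `1/4` each, then
`P_p(ladderEventFin) ≥ P_p(0 ↔ ∂Λ_M) · c^{3 + 2k₀} / 2` (all events being increasing and local:
`sitePercolation_harris`, `sitePercolation_real_biInter_ge_prod`,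
`measureReal_biInter_ge_one_sub_sum`). [cite: Nolin2008, §7.4, Cor. 41 (proof; arXiv 0711.4948: Cor. 39)] -/
theorem real_ladderEventFin_ge (p : unitInterval) {c : ℝ} (hc0 : 0 ≤ c) {M m k₀ K : ℕ}
    (hcT : c ≤ (triSitePercolation p).real (hookTop m))
    (hcB : c ≤ (triSitePercolation p).real (hookBot m))
    (hcL : c ≤ (triSitePercolation p).real (hookLeft m))
    (hcR : ∀ k, c ≤ (triSitePercolation p).real (ladderRung m k))
    (hcH : ∀ k, c ≤ (triSitePercolation p).real (ladderRail m k))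
    (htR : ∑ k ∈ Finset.Ico k₀ (k₀ + K), (1 - (triSitePercolation p).real (ladderRung m k)) ≤ 1 / 4)
    (htH : ∑ k ∈ Finset.Ico k₀ (k₀ + K), (1 - (triSitePercolation p).real (ladderRail m k)) ≤ 1 / 4) :
    (triSitePercolation p).real (triOneArm M) * (c ^ (3 + 2 * k₀) / 2) ≤
      (triSitePercolation p).real (ladderEventFin M m k₀ K) := by
  classical
  -- notation
  set μ := triSitePercolation p with hμ
  have hμ' : μ = sitePercolation (Site 2) p := rfl
  set F := ladderFinset M m (k₀ + K) with hF
  set T := hookTop m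
  set B := hookBot m
  set L := hookLeft m
  set HR := ⋂ k ∈ Finset.range k₀, ladderRung m k with hHR
  set HH := ⋂ k ∈ Finset.range k₀, ladderRail m k with hHH
  set TR := ⋂ k ∈ Finset.Ico k₀ (k₀ + K), ladderRung m k with hTR
  set TH := ⋂ k ∈ Finset.Ico k₀ (k₀ + K), ladderRail m k with hTH
  -- locality and monotonicity of the pieces
  have dA : DeterminedBy (triOneArm M) ↑F := determinedBy_arm_fin M m k₀ K
  have dT : DeterminedBy T ↑F := determinedBy_hookTop_fin M m k₀ K
  have dB : DeterminedBy B ↑F := determinedBy_hookBot_fin M m k₀ K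
  have dL : DeterminedBy L ↑F := determinedBy_hookLeft_fin M m k₀ K
  have dHR : DeterminedBy HR ↑F := determinedBy_rungs_fin M m k₀ K (range_subset_range_add k₀ K)
  have dHH : DeterminedBy HH ↑F := determinedBy_rails_fin M m k₀ K (range_subset_range_add k₀ K)
  have dTR : DeterminedBy TR ↑F := determinedBy_rungs_fin M m k₀ K (Ico_subset_range_add k₀ K)
  have dTH : DeterminedBy TH ↑F := determinedBy_rails_fin M m k₀ K (Ico_subset_range_add k₀ K)
  have uA : IsUpperSet (triOneArm M) := isUpperSet_triOneArm M
  have uT : IsUpperSet T := isUpperSet_hookTop m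
  have uB : IsUpperSet B := isUpperSet_hookBot m
  have uL : IsUpperSet L := isUpperSet_hookLeft m
  have uHR : IsUpperSet HR := isUpperSet_iInter₂ fun k _ => isUpperSet_ladderRung m k
  have uHH : IsUpperSet HH := isUpperSet_iInter₂ fun k _ => isUpperSet_ladderRail m k
  have uTR : IsUpperSet TR := isUpperSet_iInter₂ fun k _ => isUpperSet_ladderRung m k
  have uTH : IsUpperSet TH := isUpperSet_iInter₂ fun k _ => isUpperSet_ladderRail m k
  -- Harris, step by step
  have harris : ∀ {X Y : Set (SiteConfig (Site 2))}, DeterminedBy X ↑F → DeterminedBy Y ↑F →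
      IsUpperSet X → IsUpperSet Y → μ.real X * μ.real Y ≤ μ.real (X ∩ Y) := by
    intro X Y dX dY uX uY
    rw [hμ']
    exact sitePercolation_harris p dX dY uX uY
  have nn : ∀ X : Set (SiteConfig (Site 2)), 0 ≤ μ.real X := fun X => measureReal_nonneg
  -- heads
  have hHRc : c ^ k₀ ≤ μ.real HR := by
    have h := sitePercolation_real_biInter_ge_prod (V := Site 2) p (Finset.range k₀)
      (E := fun k => ladderRung m k)
      (F := fun k => (rectangle (ladderScale m k) (4 * ladderScale m k)).image
        (fun z => z + ![(ladderScale m k : ℤ), -(2 * (ladderScale m k : ℤ))]))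
      (fun k _ => determinedBy_shift_triTBCrossing _ _ _) (fun k _ => isUpperSet_ladderRung m k)
    rw [← hμ'] at h
    refine le_trans ?_ h
    calc c ^ k₀ = ∏ _k ∈ Finset.range k₀, c := by simp
      _ ≤ ∏ k ∈ Finset.range k₀, μ.real (ladderRung m k) :=
          Finset.prod_le_prod (fun _ _ => hc0) fun k _ => hcR k
  have hHHc : c ^ k₀ ≤ μ.real HH := by
    have h := sitePercolation_real_biInter_ge_prod (V := Site 2) p (Finset.range k₀)
      (E := fun k => ladderRail m k)
      (F := fun k => (rectangle (3 * ladderScale m k) (2 * ladderScale m k)).image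
        (fun z => z + ![(ladderScale m k : ℤ), -(ladderScale m k : ℤ)]))
      (fun k _ => determinedBy_shift_triLRCrossing _ _ _) (fun k _ => isUpperSet_ladderRail m k)
    rw [← hμ'] at h
    refine le_trans ?_ h
    calc c ^ k₀ = ∏ _k ∈ Finset.range k₀, c := by simp
      _ ≤ ∏ k ∈ Finset.range k₀, μ.real (ladderRail m k) :=
          Finset.prod_le_prod (fun _ _ => hc0) fun k _ => hcH k
  -- tails
  have mR : ∀ k, MeasurableSet (ladderRung m k) := fun k => measurableSet_shift_triTBCrossing _ _ _
  have mH : ∀ k, MeasurableSet (ladderRail m k) := fun k => measurableSet_shift_triLRCrossing _ _ _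
  have hTRc : 3 / 4 ≤ μ.real TR := by
    have := measureReal_biInter_ge_one_sub_sum μ (Finset.Ico k₀ (k₀ + K))
      (E := fun k => ladderRung m k) fun k _ => mR k
    linarith
  have hTHc : 3 / 4 ≤ μ.real TH := by
    have := measureReal_biInter_ge_one_sub_sum μ (Finset.Ico k₀ (k₀ + K))
      (E := fun k => ladderRail m k) fun k _ => mH k
    linarith
  have hTail : 1 / 2 ≤ μ.real (TR ∩ TH) := by
    have := measureReal_inter_ge_add_sub_one μ (X := TR) (Y := TH)
      (Finset.measurableSet_biInter _ fun k _ => mH k)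
    linarith
  -- assembling the head: `T ∩ B ∩ L ∩ (HR ∩ HH)`
  have h1 : c * c ≤ μ.real (T ∩ B) :=
    le_trans (mul_le_mul hcT hcB hc0 (nn T)) (harris dT dB uT uB)
  have h2 : c * c * c ≤ μ.real (T ∩ B ∩ L) :=
    le_trans (mul_le_mul h1 hcL hc0 (nn _)) (harris (dT.inter dB) dL (uT.inter uB) uL)
  have h3 : c ^ k₀ * c ^ k₀ ≤ μ.real (HR ∩ HH) :=
    le_trans (mul_le_mul hHRc hHHc (pow_nonneg hc0 _) (nn HR)) (harris dHR dHH uHR uHH)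
  have h4 : c * c * c * (c ^ k₀ * c ^ k₀) ≤ μ.real (T ∩ B ∩ L ∩ (HR ∩ HH)) :=
    le_trans (mul_le_mul h2 h3 (by positivity) (nn _))
      (harris ((dT.inter dB).inter dL) (dHR.inter dHH) ((uT.inter uB).inter uL) (uHR.inter uHH))
  -- head and tail
  have h5 : c * c * c * (c ^ k₀ * c ^ k₀) * (1 / 2) ≤
      μ.real (T ∩ B ∩ L ∩ (HR ∩ HH) ∩ (TR ∩ TH)) :=
    le_trans (mul_le_mul h4 hTail (by norm_num) (nn _))
      (harris (((dT.inter dB).inter dL).inter (dHR.inter dHH)) (dTR.inter dTH)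
        (((uT.inter uB).inter uL).inter (uHR.inter uHH)) (uTR.inter uTH))
  -- the arm in front
  have h6 := harris dA ((((dT.inter dB).inter dL).inter (dHR.inter dHH)).inter (dTR.inter dTH))
    uA ((((uT.inter uB).inter uL).inter (uHR.inter uHH)).inter (uTR.inter uTH))
  have hshape : triOneArm M ∩ (T ∩ B ∩ L ∩ (HR ∩ HH) ∩ (TR ∩ TH)) = ladderEventFin M m k₀ K := rfl
  rw [hshape] at h6
  refine le_trans ?_ h6
  have hc_eq : c ^ (3 + 2 * k₀) / 2 = c * c * c * (c ^ k₀ * c ^ k₀) * (1 / 2) := by ring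
  rw [hc_eq]
  exact mul_le_mul_of_nonneg_left h5 (nn _)

/-! ### Passing to the infinite ladder -/

/-- The finite-ladder event is local. [folklore] -/
theorem determinedBy_ladderEventFin (M m k₀ K : ℕ) :
    DeterminedBy (ladderEventFin M m k₀ K) ↑(ladderFinset M m (k₀ + K)) :=
  (determinedBy_arm_fin M m k₀ K).inter
    (((((determinedBy_hookTop_fin M m k₀ K).inter (determinedBy_hookBot_fin M m k₀ K)).inter
      (determinedBy_hookLeft_fin M m k₀ K)).inter
      ((determinedBy_rungs_fin M m k₀ K (range_subset_range_add k₀ K)).inter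
        (determinedBy_rails_fin M m k₀ K (range_subset_range_add k₀ K)))).inter
      ((determinedBy_rungs_fin M m k₀ K (Ico_subset_range_add k₀ K)).inter
        (determinedBy_rails_fin M m k₀ K (Ico_subset_range_add k₀ K))))

/-- The finite-ladder event is measurable. [folklore] -/
theorem measurableSet_ladderEventFin (M m k₀ K : ℕ) : MeasurableSet (ladderEventFin M m k₀ K) :=
  (determinedBy_ladderEventFin M m k₀ K).measurableSet_of_finset

/-- **Continuity along the decreasing finite ladders**: a uniform lower bound for the
probabilities of the finite-ladder events bounds the probability of their intersection
(`tendsto_measure_iInter_atTop`). [folklore] -/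
theorem real_iInter_ladderEventFin_ge (p : unitInterval) {b : ℝ} {M m k₀ : ℕ}
    (h : ∀ K, b ≤ (triSitePercolation p).real (ladderEventFin M m k₀ K)) :
    b ≤ (triSitePercolation p).real (⋂ K, ladderEventFin M m k₀ K) := by
  set μ := triSitePercolation p with hμ
  have ht := tendsto_measure_iInter_atTop (μ := μ) (s := ladderEventFin M m k₀)
    (fun K => (measurableSet_ladderEventFin M m k₀ K).nullMeasurableSet)
    (antitone_ladderEventFin M m k₀) ⟨0, measure_ne_top _ _⟩
  have hK : ∀ K, ENNReal.ofReal b ≤ μ (ladderEventFin M m k₀ K) := fun K =>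
    (ENNReal.ofReal_le_iff_le_toReal (measure_ne_top _ _)).2 (h K)
  have hlim : ENNReal.ofReal b ≤ μ (⋂ K, ladderEventFin M m k₀ K) :=
    ge_of_tendsto' ht fun K => hK K
  exact (ENNReal.ofReal_le_iff_le_toReal (measure_ne_top _ _)).1 hlim

/-! ### The theorem -/

/-- **At distance `L(p)` one is not far from infinity** (Nolin 2008, §7.4, Cor. 41
[arXiv 0711.4948: Cor. 39]; Werner 2009, Lecture 6, §1; Kesten 1987): the named fact
`Nolin2008_cor41` — for every `ε ∈ (0, 1/2)` there are `δ, c > 0` with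
`c · P_p(0 ↔ ∂Λ_{L_ε(p)}) ≤ θ(p)` for `1/2 < p < 1/2 + δ` — follows from RSW at `p = 1/2`
(`tri_rsw_half`), the uniform exponential decay above `L(p)` (`Nolin2008_lemma39`) and the
sub-critical decay of crossings (`Nolin2008_subcritical_crossing`, through
`le_charLength_eventually`: `L_ε(p) ≥ 8` near `1/2`). See the module docstring for the proof.
This `_at` form works at ONE `ε ∈ (0, 1/2)` and uses the exponential decay at that `ε` (aspect
ratios `4` and `2`) only, so that `ε`-restricted discharges of `Nolin2008_lemma39` suffice;
`Nolin2008_cor41_of_ladder` is the statement for all `ε`. [cite: Nolin2008, §7.4, Cor. 41 (arXiv 0711.4948: Cor. 39)] [cite: WernerPCMI2009, Lecture 6, §1 (display: θ(p) ≥ c₃ P_p(0 ↔ ∂Λ_{L(p)}))] -/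
theorem Nolin2008_cor41_at_of_ladder {ε : ℝ} (hε : 0 < ε) (hε' : ε < 1 / 2)
    (hrsw : tri_rsw_half)
    (h39₄ : ∃ C₁ > (0 : ℝ), ∃ C₂ > (0 : ℝ), ∀ p : unitInterval, ε < (p : ℝ) → (p : ℝ) < 1 / 2 →
      ∀ n : ℕ, 1 ≤ n → triLRCrossingProb p n (4 * n) ≤ C₁ * Real.exp (-(C₂ * n / charLength ε p)))
    (h39₂ : ∃ C₁ > (0 : ℝ), ∃ C₂ > (0 : ℝ), ∀ p : unitInterval, ε < (p : ℝ) → (p : ℝ) < 1 / 2 →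
      ∀ n : ℕ, 1 ≤ n → triLRCrossingProb p n (2 * n) ≤ C₁ * Real.exp (-(C₂ * n / charLength ε p)))
    (hsub : Nolin2008_subcritical_crossing) :
    ∃ δ > (0 : ℝ), ∃ c > (0 : ℝ),
      ∀ p : unitInterval, 1 / 2 < (p : ℝ) → (p : ℝ) < 1 / 2 + δ →
        c * (triSitePercolation p).real (triOneArm (charLength ε p)) ≤ triTheta p := by
  obtain ⟨c, hc, hc4, hc3⟩ := rsw_ladder_constant hrsw
  obtain ⟨C₁, hC₁, C₂, hC₂, h4⟩ := h39₄
  obtain ⟨C₁', hC₁', C₂', hC₂', h2⟩ := h39₂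
  obtain ⟨k₀, hk₀⟩ := ladder_tail_index hC₁ hC₂ hC₁' hC₂'
  obtain ⟨δL, hδL, hL⟩ :=
    le_charLength_eventually BollobasRiordan2006_ch5_lemma7_holds hsub hε hε' 8
  refine ⟨min δL (1 / 2 - ε), lt_min hδL (by linarith), c ^ (3 + 2 * k₀) / 2, by positivity,
    fun p hp1 hp2 => ?_⟩
  have hδ1 := min_le_left δL (1 / 2 - ε)
  have hδ2 := min_le_right δL (1 / 2 - ε)
  -- the dual parameter `1 - p ∈ (1/2 - δL, 1/2)`, `1 - p > ε`
  have hσ : ((σ p : unitInterval) : ℝ) = 1 - p := unitInterval.coe_symm_eq p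
  have hσ1 : 1 / 2 - δL < ((σ p : unitInterval) : ℝ) := by rw [hσ]; linarith
  have hσ2 : ((σ p : unitInterval) : ℝ) < 1 / 2 := by rw [hσ]; linarith
  have hσε : ε < ((σ p : unitInterval) : ℝ) := by rw [hσ]; linarith
  have hp : half ≤ p := Subtype.coe_le_coe.1 (by rw [coe_half]; linarith)
  -- the scales `M = L_ε(p) ≥ 8`, `m = ⌊M/4⌋`
  set M := charLength ε p with hM
  have hM8 : 8 ≤ M := by rw [hM, ← charLength_symm]; exact hL (σ p) hσ1 hσ2
  set m := M / 4 with hm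
  have hm1 : 1 ≤ m := by omega
  have h4m : 4 * m ≤ M := by omega
  have hM8m : M < 8 * m := by omega
  -- the building blocks
  have hcT : c ≤ (triSitePercolation p).real (hookTop m) := (hc4 m hm1).trans (le_real_hookTop hp m)
  have hcB : c ≤ (triSitePercolation p).real (hookBot m) := (hc4 m hm1).trans (le_real_hookBot hp m)
  have hcL : c ≤ (triSitePercolation p).real (hookLeft m) :=
    (hc4 m hm1).trans (le_real_hookLeft hp m)
  have hcR : ∀ k, c ≤ (triSitePercolation p).real (ladderRung m k) := fun k =>
    (hc4 _ (ladderScale_pos hm1 k)).trans (le_real_ladderRung hp m k)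
  have hcH : ∀ k, c ≤ (triSitePercolation p).real (ladderRail m k) := fun k =>
    (hc3 _ (ladderScale_pos hm1 k)).trans (le_real_ladderRail hp m k)
  -- the tails
  have htR : ∀ K, ∑ k ∈ Finset.Ico k₀ (k₀ + K),
      (1 - (triSitePercolation p).real (ladderRung m k)) ≤ 1 / 4 := fun K => by
    refine le_trans (Finset.sum_le_sum fun k _ => ?_) (hk₀ M m hm1 h4m hM8m K).1
    have h := h4 (σ p) hσε hσ2 (ladderScale m k) (ladderScale_pos hm1 k)
    rw [charLength_symm] at h
    exact (one_sub_real_ladderRung_le p m k).trans h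
  have htH : ∀ K, ∑ k ∈ Finset.Ico k₀ (k₀ + K),
      (1 - (triSitePercolation p).real (ladderRail m k)) ≤ 1 / 4 := fun K => by
    refine le_trans (Finset.sum_le_sum fun k _ => ?_) (hk₀ M m hm1 h4m hM8m K).2
    have h := h2 (σ p) hσε hσ2 (2 * ladderScale m k)
      (by have := ladderScale_pos hm1 k; omega)
    rw [charLength_symm] at h
    exact (one_sub_real_ladderRail_le p m k).trans h
  -- finite ladders, the limit, and the conclusion
  have hfin : ∀ K, (triSitePercolation p).real (triOneArm M) * (c ^ (3 + 2 * k₀) / 2) ≤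
      (triSitePercolation p).real (ladderEventFin M m k₀ K) := fun K =>
    real_ladderEventFin_ge p hc.le hcT hcB hcL hcR hcH (htR K) (htH K)
  have hinf := real_iInter_ladderEventFin_ge p hfin
  calc c ^ (3 + 2 * k₀) / 2 * (triSitePercolation p).real (triOneArm M)
        = (triSitePercolation p).real (triOneArm M) * (c ^ (3 + 2 * k₀) / 2) := by ring
    _ ≤ (triSitePercolation p).real (⋂ K, ladderEventFin M m k₀ K) := hinf
    _ ≤ (triSitePercolation p).real (ladderEvent M m) :=
        measureReal_mono (iInter_ladderEventFin_subset M m k₀) (measure_ne_top _ _)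
    _ ≤ (triSitePercolation p).real (sitePercolatesAt triGraph 0) :=
        measureReal_mono (ladderEvent_subset_sitePercolatesAt hm1 h4m) (measure_ne_top _ _)
    _ = triTheta p := (triTheta_eq p).symm

/-- **At distance `L(p)` one is not far from infinity**, for all `ε`: the named fact
`Nolin2008_cor41` from `tri_rsw_half`, `Nolin2008_lemma39` and `Nolin2008_subcritical_crossing`
(`Nolin2008_cor41_at_of_ladder` at each `ε`). [cite: Nolin2008, §7.4, Cor. 41 (arXiv 0711.4948: Cor. 39)] -/
theorem Nolin2008_cor41_of_ladder (hrsw : tri_rsw_half) (h39 : Nolin2008_lemma39)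
    (hsub : Nolin2008_subcritical_crossing) : Nolin2008_cor41 := fun _ hε hε' =>
  Nolin2008_cor41_at_of_ladder hε hε' hrsw (h39 hε hε' 4 (by norm_num)) (h39 hε hε' 2 (by norm_num))
    hsub

/-- **crit-perc.S16 from its current leaves** (after this layer): `θ(p) = (p - 1/2)^{5/36 + o(1)}`
as `p ↓ 1/2` (Smirnov–Werner 2001, Thm. 1; Kesten 1987) follows from the two critical arm
exponents (`oneArm_exponent`, `fourArm_exponent`), the exponential decay of the radius below
`1/2` (`BollobasRiordan2006_tri_expDecay`), the pivotal count below `L(p)`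
(`Werner2009_lemma62`), the near-critical stability of the one-arm probability
(`Nolin2008_thm27_oneArm`), RSW at `p = 1/2` (`tri_rsw_half`) and the uniform exponential decay
above `L(p)` (`Nolin2008_lemma39`) — through `triTheta_exponent_of_leaves`
(`KestenRelationRussoProofs.lean`) and `Nolin2008_cor41_of_ladder`. [cite: SmirnovWernerMRL2001, §2 (paragraph after the theorem "Behaviour near the critical point")] [cite: Nolin2008, §7.4, "Consequence for θ" (displays θ(p) ≈ L(p)^{-5/48} ≈ (p-1/2)^{5/36})] -/
theorem triTheta_exponent_of_leaves' (h₁ : oneArm_exponent) (h₄ : fourArm_exponent)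
    (hdec : BollobasRiordan2006_tri_expDecay) (h62 : Werner2009_lemma62)
    (h27 : Nolin2008_thm27_oneArm) (hrsw : tri_rsw_half) (h39 : Nolin2008_lemma39) :
    triTheta_exponent :=
  triTheta_exponent_of_leaves h₁ h₄ hdec h62 h27
    (Nolin2008_cor41_of_ladder hrsw h39 (Nolin2008_subcritical_crossing_of_expDecay hdec))

end Literature.Probability.Percolation
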